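import Literature.Analysis.FluidPDE.ForwardDSSRepresentative
import Literature.Analysis.FunctionSpaces.WeakCompactnessL1
import HarnessLib

/-!
# Forward DSS solutions: limits of DSS fields are DSS almost everywhere

Analysis/FluidPDE support file (theorems only) for the forward discretely self-similar (DSS)
existence theory of Bradshaw–Tsai (Analysis & PDE 12 (2019), Thm 1.2; facts
`bradshawTsai2019_limit_4_3_local`, `bradshawTsai2019_limit_4_3_ae`,
`bradshawTsai2019_cylinderLimit`). In §4.3 of loc. cit. the limit `(v, π)` of the `λ`-DSS local
Leray solutions `(v_k, π_k)` on the unit cylinder `Q = (0, T) × B₁` inherits discrete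
self-similarity near the origin ("`v_k` satisfies (eq.NSE) on `Q_κ` and satisfies (v.eq-core) for
every `m ∈ ℤ` and `φ ∈ 𝒟^m_{Q_κ}`. Thus, `v` can be extended to a DSS solution", arXiv p. 12).
At the level of Lebesgue classes this is the elementary remark that limits of scaling-invariant
functions are scaling-invariant almost everywhere, which this file proves in the two forms the
passage to the limit delivers:

* `BradshawTsai2019.ae_dss_of_tendsto_setLIntegral` — **velocities**: if the `v_k` are exactly
  `λ`-DSS and `v_k → u` in `L²` of every interior cylinder `(δ, T − δ) × B_r` (`δ > 0`, `r < 1`),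
  then `u(t/λ², x/λ) = λ u(t, x)` for a.e. `(t, x) ∈ Q` (compare `u` with `v_k` on an interior
  cylinder and on its shrink, change variables `(t, x) ↦ (t/λ², x/λ)`);
* `BradshawTsai2019.ae_pressure_dss_of_tendstoWeaklyL1` — **pressures**: if the `π_k` are exactly
  `λ`-DSS pressures and `π_k ⇀ p` weakly in `L¹(Q)`
  (`Literature.Analysis.FunctionSpaces.TendstoWeaklyL1`, the mode of convergence produced by the
  Dunford–Pettis theorem from a uniform `L^{3/2}` bound), then `p(t/λ², x/λ) = λ² p(t, x)` for a.e.
  `(t, x) ∈ Q` (test against `θ ∈ C_c^∞(Q)` and `θ ∘ (λ²·, λ·)`, change variables, and conclude by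
  the fundamental lemma of the calculus of variations,
  `IsOpen.ae_eq_zero_of_integral_contDiff_smul_eq_zero`).

The shrinking `(t, x) ↦ (t/λ², x/λ)` is the accepted `BradshawTsai2019.stDilate c (-1)`
(`ForwardDSSRepresentative.lean`), under which the a.e. identities feed
`BradshawTsai2019.dssExtend_ae_eq_of_ae`.

## References

* Z. Bradshaw, T.-P. Tsai, Analysis & PDE 12 (2019) = arXiv:1801.08060, §4.2–§4.3
  [BradshawTsai2019].
-/

noncomputable section

open MeasureTheory TopologicalSpace Set Function Filter Metric Module
open scoped ENNReal NNReal Topology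

namespace Literature.Analysis.FluidPDE

namespace BradshawTsai2019

variable {E : Type*} [NormedAddCommGroup E] [InnerProductSpace ℝ E] [FiniteDimensional ℝ E]
  [MeasurableSpace E] [BorelSpace E]

/-! ### The shrinking as an affine map; cylinders -/

omit [FiniteDimensional ℝ E] [MeasurableSpace E] [BorelSpace E] in
/-- `stDilate c (-1)` is the space–time affine map `stAffine c⁻² c⁻¹ 0 0`. [folklore] -/
theorem stDilate_neg_one_eq_stAffine (c : ℝ) :
    (stDilate c (-1) : ℝ × E → ℝ × E) = stAffine (c⁻¹ ^ 2) c⁻¹ 0 (0 : E) := by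
  rw [stDilate_eq_stAffine, zpow_neg, zpow_one]

omit [FiniteDimensional ℝ E] [MeasurableSpace E] [BorelSpace E] in
/-- The preimage of the cylinder `(a/c², b/c²) × B_{r/c}` under the shrinking is `(a, b) × B_r`
(`c > 0`). [folklore] -/
theorem stDilate_neg_one_preimage_cylinder {c : ℝ} (hc : 0 < c) (a b r : ℝ) :
    (stDilate c (-1) : ℝ × E → ℝ × E) ⁻¹' (Ioo (a / c ^ 2) (b / c ^ 2) ×ˢ ball (0 : E) (r / c)) =
      Ioo a b ×ˢ ball (0 : E) r := by
  have hc2 : 0 < c ^ 2 := pow_pos hc 2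
  rw [stDilate_neg_one_eq_stAffine, stAffine_preimage_cylinder (by positivity) (inv_pos.2 hc)]
  congr 1
  · rw [sub_zero, sub_zero]
    congr 1 <;> field_simp
  · rw [sub_zero, smul_zero]
    congr 1
    field_simp

/-- Change of variables for set lower integrals under the shrinking:
`∫⁻_{(a,b)×B_r} F(t/c², x/c) = c^{2+n} ∫⁻_{(a/c²,b/c²)×B_{r/c}} F` (`c > 0`, `n = dim E`). [folklore] -/
theorem setLIntegral_comp_stDilate_neg_one {c : ℝ} (hc : 0 < c) (a b r : ℝ) (F : ℝ × E → ℝ≥0∞) :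
    ∫⁻ z in Ioo a b ×ˢ ball (0 : E) r, F (stDilate c (-1) z) =
      ENNReal.ofReal ((c⁻¹ ^ 2) * c⁻¹ ^ finrank ℝ E)⁻¹ *
        ∫⁻ z in Ioo (a / c ^ 2) (b / c ^ 2) ×ˢ ball (0 : E) (r / c), F z := by
  rw [← stDilate_neg_one_preimage_cylinder (E := E) hc a b r, stDilate_neg_one_eq_stAffine]
  exact setLIntegral_preimage_comp_stAffine (by positivity) (inv_pos.2 hc) 0 (0 : E) F _

/-- A.e.-strong measurability of `g ∘ (shrinking)` on a cylinder from that of `g` on the shrunk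
cylinder (the shrinking is a measurable bijection scaling Lebesgue measure). [folklore] -/
theorem aestronglyMeasurable_comp_stDilate_neg_one {F : Type*} [TopologicalSpace F]
    {c : ℝ} (hc : 0 < c) {a b r : ℝ} {g : ℝ × E → F}
    (hg : AEStronglyMeasurable g
      (volume.restrict (Ioo (a / c ^ 2) (b / c ^ 2) ×ˢ ball (0 : E) (r / c)))) :
    AEStronglyMeasurable (g ∘ stDilate c (-1)) (volume.restrict (Ioo a b ×ˢ ball (0 : E) r)) := by
  have hme := measurableEmbedding_stAffine (E := E) (β := c⁻¹ ^ 2) (γ := c⁻¹) (by positivity)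
    (inv_pos.2 hc).ne' 0 0
  rw [← stDilate_neg_one_preimage_cylinder (E := E) hc a b r, stDilate_neg_one_eq_stAffine]
  refine (hme.aestronglyMeasurable_map_iff).1 ?_
  rw [map_stAffine_volume_restrict_preimage (by positivity) (inv_pos.2 hc)]
  exact hg.smul_measure _

/-! ### Velocities: strong interior `L²` limits of DSS fields -/

/-- **Interior `L²` limits of `λ`-DSS fields are `λ`-DSS a.e. on one interior cylinder.** [folklore] -/
theorem ae_dss_on_cylinder_of_tendsto {F : Type*} [NormedAddCommGroup F] [NormedSpace ℝ F]
    {c : ℝ} (hc : 1 < c) {T : ℝ} (hT : 0 < T) {v : ℕ → ℝ → E → F} {u : ℝ → E → F}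
    (hv : ∀ j, IsDiscretelySelfSimilar c (v j))
    (hvm : ∀ j, AEStronglyMeasurable (uncurry (v j)) (volume.restrict (Ioo 0 T ×ˢ ball (0 : E) 1)))
    (hum : AEStronglyMeasurable (uncurry u) (volume.restrict (Ioo 0 T ×ˢ ball (0 : E) 1)))
    (hconv : ∀ δ r : ℝ, 0 < δ → r < 1 →
      Tendsto (fun j => ∫⁻ z in Ioo δ (T - δ) ×ˢ ball (0 : E) r,
        ‖v j z.1 z.2 - u z.1 z.2‖ₑ ^ 2) atTop (𝓝 0))
    {δ r : ℝ} (hδ : 0 < δ) (hr : r < 1) :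
    ∀ᵐ z : ℝ × E ∂volume, z ∈ Ioo δ (T - δ) ×ˢ ball (0 : E) r →
      uncurry u (stDilate c (-1) z) = c • uncurry u z := by
  have hc0 : 0 < c := one_pos.trans hc
  have hc0' : c ≠ 0 := hc0.ne'
  have hc1 : 1 ≤ c ^ 2 := one_le_pow₀ hc.le
  set Q' : Set (ℝ × E) := Ioo δ (T - δ) ×ˢ ball (0 : E) r with hQ'
  set Q'' : Set (ℝ × E) := Ioo (δ / c ^ 2) ((T - δ) / c ^ 2) ×ˢ ball (0 : E) (r / c) with hQ''
  have hQ'm : MeasurableSet Q' := measurableSet_Ioo.prod measurableSet_ball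
  -- the shrunk cylinder `Q''` lies in the interior cylinder with parameters `δ/c²`, `r/c`
  have hδ' : 0 < δ / c ^ 2 := by positivity
  have hr' : r / c < 1 := by
    rw [div_lt_one hc0]; exact hr.trans hc
  have hQ''sub : Q'' ⊆ Ioo (δ / c ^ 2) (T - δ / c ^ 2) ×ˢ ball (0 : E) (r / c) := by
    refine prod_mono (Ioo_subset_Ioo le_rfl ?_) Subset.rfl
    rw [div_le_iff₀ (by positivity : (0 : ℝ) < c ^ 2), sub_mul,
      div_mul_cancel₀ δ (by positivity : (c : ℝ) ^ 2 ≠ 0)]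
    have hTc : T * 1 ≤ T * c ^ 2 := mul_le_mul_of_nonneg_left hc1 hT.le
    linarith
  -- both cylinders lie in the unit cylinder
  have hQ'sub : Q' ⊆ Ioo 0 T ×ˢ ball (0 : E) 1 :=
    prod_mono (Ioo_subset_Ioo hδ.le (by linarith)) (ball_subset_ball hr.le)
  have hQ''sub1 : Q'' ⊆ Ioo 0 T ×ˢ ball (0 : E) 1 :=
    hQ''sub.trans (prod_mono (Ioo_subset_Ioo hδ'.le (by linarith [hδ'])) (ball_subset_ball hr'.le))
  -- measurability of the integrands
  have humQ' : AEStronglyMeasurable (uncurry u) (volume.restrict Q') := hum.mono_set hQ'sub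
  have humΦ : AEStronglyMeasurable (uncurry u ∘ stDilate c (-1)) (volume.restrict Q') :=
    aestronglyMeasurable_comp_stDilate_neg_one hc0 (hum.mono_set hQ''sub1)
  have hvmΦ : ∀ j, AEStronglyMeasurable (uncurry (v j) ∘ stDilate c (-1)) (volume.restrict Q') :=
    fun j => aestronglyMeasurable_comp_stDilate_neg_one hc0 ((hvm j).mono_set hQ''sub1)
  -- the defect `D = ∫⁻_{Q'} ‖u(t/c², x/c) − c u(t, x)‖²`
  set D : ℝ≥0∞ := ∫⁻ z in Q', ‖uncurry u (stDilate c (-1) z) - c • uncurry u z‖ₑ ^ 2 with hD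
  -- the two error terms
  set A : ℕ → ℝ≥0∞ := fun j => ∫⁻ z in Q', ‖v j z.1 z.2 - u z.1 z.2‖ₑ ^ 2 with hA
  set A' : ℕ → ℝ≥0∞ := fun j => ∫⁻ z in Ioo (δ / c ^ 2) (T - δ / c ^ 2) ×ˢ ball (0 : E) (r / c),
    ‖v j z.1 z.2 - u z.1 z.2‖ₑ ^ 2 with hA'
  have hA0 : Tendsto A atTop (𝓝 0) := hconv δ r hδ hr
  have hA'0 : Tendsto A' atTop (𝓝 0) := hconv (δ / c ^ 2) (r / c) hδ' hr'
  set κ : ℝ≥0∞ := ENNReal.ofReal ((c⁻¹ ^ 2) * c⁻¹ ^ finrank ℝ E)⁻¹ with hκ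
  -- the basic estimate `D ≤ 2 κ A' j + 2 c² A j`
  have hest : ∀ j, D ≤ 2 * (κ * A' j) + 2 * (ENNReal.ofReal (c ^ 2) * A j) := by
    intro j
    -- `‖x + y‖ₑ² ≤ 2‖x‖ₑ² + 2‖y‖ₑ²`
    have hsq : ∀ x y : F, ‖x + y‖ₑ ^ 2 ≤ 2 * ‖x‖ₑ ^ 2 + 2 * ‖y‖ₑ ^ 2 := by
      intro x y
      have hr : ‖x + y‖ ^ 2 ≤ 2 * ‖x‖ ^ 2 + 2 * ‖y‖ ^ 2 := by
        nlinarith [norm_add_le x y, norm_nonneg x, norm_nonneg y, norm_nonneg (x + y),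
          sq_nonneg (‖x‖ - ‖y‖)]
      calc ‖x + y‖ₑ ^ 2 = ENNReal.ofReal (‖x + y‖ ^ 2) := by
            rw [ENNReal.ofReal_pow (norm_nonneg _), ofReal_norm]
        _ ≤ ENNReal.ofReal (2 * ‖x‖ ^ 2 + 2 * ‖y‖ ^ 2) := ENNReal.ofReal_le_ofReal hr
        _ = 2 * ‖x‖ₑ ^ 2 + 2 * ‖y‖ₑ ^ 2 := by
            rw [ENNReal.ofReal_add (by positivity) (by positivity), ENNReal.ofReal_mul zero_le_two,
              ENNReal.ofReal_mul zero_le_two, ENNReal.ofReal_pow (norm_nonneg _),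
              ENNReal.ofReal_pow (norm_nonneg _), ofReal_norm, ofReal_norm, ENNReal.ofReal_ofNat]
    have hpt : ∀ z : ℝ × E, ‖uncurry u (stDilate c (-1) z) - c • uncurry u z‖ₑ ^ 2 ≤
        2 * ‖uncurry u (stDilate c (-1) z) - uncurry (v j) (stDilate c (-1) z)‖ₑ ^ 2 +
        2 * (ENNReal.ofReal (c ^ 2) * ‖v j z.1 z.2 - u z.1 z.2‖ₑ ^ 2) := by
      intro z
      have hdss : uncurry (v j) (stDilate c (-1) z) = c • uncurry (v j) z :=
        apply_stDilate_neg_one_of_isDiscretelySelfSimilar hc0' (hv j) z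
      have e1 : uncurry u (stDilate c (-1) z) - c • uncurry u z =
          (uncurry u (stDilate c (-1) z) - uncurry (v j) (stDilate c (-1) z)) +
            c • (v j z.1 z.2 - u z.1 z.2) := by
        rw [hdss, smul_sub]; simp only [uncurry]; abel
      rw [e1]
      calc ‖(uncurry u (stDilate c (-1) z) - uncurry (v j) (stDilate c (-1) z)) +
              c • (v j z.1 z.2 - u z.1 z.2)‖ₑ ^ 2
          ≤ 2 * ‖uncurry u (stDilate c (-1) z) - uncurry (v j) (stDilate c (-1) z)‖ₑ ^ 2 +
              2 * ‖c • (v j z.1 z.2 - u z.1 z.2)‖ₑ ^ 2 := hsq _ _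
        _ = _ := by
            rw [enorm_smul, mul_pow, Real.enorm_eq_ofReal hc0.le, ← ENNReal.ofReal_pow hc0.le]
    -- change variables and enlarge the domain in the first error term
    have hX : ∫⁻ z in Q', ‖uncurry u (stDilate c (-1) z) - uncurry (v j) (stDilate c (-1) z)‖ₑ ^ 2
        ≤ κ * A' j := by
      have hcv := setLIntegral_comp_stDilate_neg_one (E := E) hc0 δ (T - δ) r
        (fun w => ‖uncurry u w - uncurry (v j) w‖ₑ ^ 2)
      rw [hcv]
      refine mul_le_mul' le_rfl ?_
      calc ∫⁻ z in Q'', ‖uncurry u z - uncurry (v j) z‖ₑ ^ 2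
          ≤ ∫⁻ z in Ioo (δ / c ^ 2) (T - δ / c ^ 2) ×ˢ ball (0 : E) (r / c),
              ‖uncurry u z - uncurry (v j) z‖ₑ ^ 2 := lintegral_mono_set hQ''sub
        _ = A' j := by
            refine lintegral_congr fun z => ?_
            simp only [uncurry]
            rw [← enorm_neg, neg_sub]
    have hmeas2 : AEMeasurable (fun z => 2 * ‖uncurry u (stDilate c (-1) z) -
        uncurry (v j) (stDilate c (-1) z)‖ₑ ^ 2) (volume.restrict Q') :=
      ((humΦ.sub (hvmΦ j)).enorm.pow_const 2).const_mul 2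
    calc D ≤ ∫⁻ z in Q', (2 * ‖uncurry u (stDilate c (-1) z) - uncurry (v j) (stDilate c (-1) z)‖ₑ ^ 2
          + 2 * (ENNReal.ofReal (c ^ 2) * ‖v j z.1 z.2 - u z.1 z.2‖ₑ ^ 2)) := lintegral_mono hpt
      _ = (2 * ∫⁻ z in Q', ‖uncurry u (stDilate c (-1) z) - uncurry (v j) (stDilate c (-1) z)‖ₑ ^ 2)
          + 2 * (ENNReal.ofReal (c ^ 2) * A j) := by
          rw [lintegral_add_left' hmeas2, lintegral_const_mul' _ _ ENNReal.ofNat_ne_top,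
            lintegral_const_mul' _ _ ENNReal.ofNat_ne_top,
            lintegral_const_mul' _ _ ENNReal.ofReal_ne_top]
      _ ≤ 2 * (κ * A' j) + 2 * (ENNReal.ofReal (c ^ 2) * A j) :=
          add_le_add (mul_le_mul' le_rfl hX) le_rfl
  -- hence `D = 0`
  have hκtop : κ ≠ ⊤ := ENNReal.ofReal_ne_top
  have hlim : Tendsto (fun j => 2 * (κ * A' j) + 2 * (ENNReal.ofReal (c ^ 2) * A j)) atTop (𝓝 0) := by
    have h1 : Tendsto (fun j => 2 * (κ * A' j)) atTop (𝓝 (2 * (κ * 0))) :=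
      ENNReal.Tendsto.const_mul (ENNReal.Tendsto.const_mul hA'0 (Or.inr hκtop))
        (Or.inr ENNReal.ofNat_ne_top)
    have h2 : Tendsto (fun j => 2 * (ENNReal.ofReal (c ^ 2) * A j)) atTop
        (𝓝 (2 * (ENNReal.ofReal (c ^ 2) * 0))) :=
      ENNReal.Tendsto.const_mul (ENNReal.Tendsto.const_mul hA0 (Or.inr ENNReal.ofReal_ne_top))
        (Or.inr ENNReal.ofNat_ne_top)
    rw [mul_zero, mul_zero] at h1 h2
    simpa using h1.add h2
  have hD0 : D = 0 := le_antisymm (ge_of_tendsto' hlim hest) zero_le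
  -- and the integrand vanishes a.e. on `Q'`
  have hmeasD : AEMeasurable (fun z => ‖uncurry u (stDilate c (-1) z) - c • uncurry u z‖ₑ ^ 2)
      (volume.restrict Q') :=
    ((humΦ.sub (humQ'.const_smul c)).enorm.pow_const 2)
  have hae := (lintegral_eq_zero_iff' hmeasD).1 hD0
  refine (ae_restrict_iff' hQ'm).1 ?_
  filter_upwards [hae] with z hz
  have hz' : ‖uncurry u (stDilate c (-1) z) - c • uncurry u z‖ₑ = 0 := by
    simpa using hz
  exact sub_eq_zero.1 (enorm_eq_zero.1 hz')

/-- **Interior `L²` limits of `λ`-DSS fields are `λ`-DSS almost everywhere** (Bradshaw–Tsai 2019,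
§4.3: the limit of the `λ`-DSS `v_k` "can be extended to a DSS solution"): if each `v_k` is
exactly `λ`-DSS and `v_k → u` in `L²((δ, T−δ) × B_r)` for all `δ > 0`, `r < 1`, then
`u(t/λ², x/λ) = λ u(t, x)` for a.e. `(t, x) ∈ (0, T) × B₁`. [cite: BradshawTsai2019, §4.3 (proof of Thm 1.2)] -/
theorem ae_dss_of_tendsto_setLIntegral {F : Type*} [NormedAddCommGroup F] [NormedSpace ℝ F]
    {c : ℝ} (hc : 1 < c) {T : ℝ} (hT : 0 < T) {v : ℕ → ℝ → E → F} {u : ℝ → E → F}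
    (hv : ∀ j, IsDiscretelySelfSimilar c (v j))
    (hvm : ∀ j, AEStronglyMeasurable (uncurry (v j)) (volume.restrict (Ioo 0 T ×ˢ ball (0 : E) 1)))
    (hum : AEStronglyMeasurable (uncurry u) (volume.restrict (Ioo 0 T ×ˢ ball (0 : E) 1)))
    (hconv : ∀ δ r : ℝ, 0 < δ → r < 1 →
      Tendsto (fun j => ∫⁻ z in Ioo δ (T - δ) ×ˢ ball (0 : E) r,
        ‖v j z.1 z.2 - u z.1 z.2‖ₑ ^ 2) atTop (𝓝 0)) :
    ∀ᵐ z : ℝ × E ∂volume, z ∈ Ioo 0 T ×ˢ ball (0 : E) 1 →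
      uncurry u (stDilate c (-1) z) = c • uncurry u z := by
  -- exhaust the unit cylinder by the interior cylinders `δ = T/(n+3)`, `r = 1 − 1/(n+2)`
  have hall : ∀ᵐ z : ℝ × E ∂volume, ∀ n : ℕ,
      z ∈ Ioo (T / (n + 3)) (T - T / (n + 3)) ×ˢ ball (0 : E) (1 - 1 / (n + 2)) →
        uncurry u (stDilate c (-1) z) = c • uncurry u z := by
    refine ae_all_iff.2 fun n => ?_
    exact ae_dss_on_cylinder_of_tendsto hc hT hv hvm hum hconv (by positivity)
      (by rw [sub_lt_self_iff]; positivity)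
  filter_upwards [hall] with z hz hzQ
  obtain ⟨⟨ht0, htT⟩, hx⟩ := hzQ
  rw [mem_ball_zero_iff] at hx
  -- choose `n` with `z` in the `n`-th interior cylinder
  obtain ⟨n, hn⟩ := exists_nat_gt (max (T / z.1) (max (T / (T - z.1)) (1 / (1 - ‖z.2‖))))
  have hn1 : T / z.1 < n := (le_max_left _ _).trans_lt hn
  have hn2 : T / (T - z.1) < n := ((le_max_left _ _).trans (le_max_right _ _)).trans_lt hn
  have hn3 : 1 / (1 - ‖z.2‖) < n := ((le_max_right _ _).trans (le_max_right _ _)).trans_lt hn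
  refine hz n ⟨⟨?_, ?_⟩, ?_⟩
  · rw [div_lt_iff₀ (by positivity)]
    rw [div_lt_iff₀ ht0] at hn1
    nlinarith
  · have hTz : 0 < T - z.1 := by linarith
    rw [div_lt_iff₀ hTz] at hn2
    rw [lt_sub_iff_add_lt, ← lt_sub_iff_add_lt', div_lt_iff₀ (by positivity)]
    nlinarith
  · rw [mem_ball_zero_iff, lt_sub_iff_add_lt, ← lt_sub_iff_add_lt']
    have hx1 : 0 < 1 - ‖z.2‖ := by linarith
    rw [div_lt_iff₀ hx1] at hn3
    rw [div_lt_iff₀ (by positivity)]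
    nlinarith

/-! ### Pressures: weak `L¹` limits of DSS pressures -/

/-- **Weak `L¹` limits of `λ`-DSS pressures are `λ`-DSS almost everywhere** (Bradshaw–Tsai 2019,
§4.3: the pressure `π` of the limit is identified through the `λ`-DSS pressures `π_k`): if each
`π_k` is exactly a `λ`-DSS pressure (`λ² π_k(λ²t, λx) = π_k(t, x)`), `p` is integrable on the unit
cylinder `Q = (0, T) × B₁` and `π_k ⇀ p` weakly in `L¹(Q)` (tested against essentially bounded
multipliers), then `p(t/λ², x/λ) = λ² p(t, x)` for a.e. `(t, x) ∈ Q`. [cite: BradshawTsai2019, §4.3 (proof of Thm 1.2)] -/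
theorem ae_pressure_dss_of_tendstoWeaklyL1 {c : ℝ} (hc : 1 < c) {T : ℝ}
    {π : ℕ → ℝ → E → ℝ} {p : ℝ → E → ℝ} (hπ : ∀ j, nsRescalePressure c (π j) = π j)
    (hp : IntegrableOn (uncurry p) (Ioo 0 T ×ˢ ball (0 : E) 1) volume)
    (hw : FunctionSpaces.TendstoWeaklyL1 (fun j z => π j z.1 z.2) (fun z => p z.1 z.2)
      (volume.restrict (Ioo 0 T ×ˢ ball (0 : E) 1))) :
    ∀ᵐ z : ℝ × E ∂volume, z ∈ Ioo 0 T ×ˢ ball (0 : E) 1 →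
      uncurry p (stDilate c (-1) z) = c ^ 2 * uncurry p z := by
  have hc0 : 0 < c := one_pos.trans hc
  have hc0' : c ≠ 0 := hc0.ne'
  set Q : Set (ℝ × E) := Ioo 0 T ×ˢ ball (0 : E) 1 with hQ
  have hQo : IsOpen Q := isOpen_Ioo.prod isOpen_ball
  have hQm : MeasurableSet Q := hQo.measurableSet
  have hW := stDilate_neg_one_mem_cylinder (E := E) hc.le T 1
  -- the constant of the change of variables
  set κ : ℝ := ((c⁻¹ ^ 2) * c⁻¹ ^ finrank ℝ E)⁻¹ with hκ
  -- integrability of `p ∘ shrink` on `Q`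
  have hpΦ : IntegrableOn (uncurry p ∘ stDilate c (-1)) Q volume := by
    have h1 : IntegrableOn (uncurry p ∘ stDilate c (-1)) ((stDilate c (-1)) ⁻¹' Q) volume := by
      rw [stDilate_neg_one_eq_stAffine]
      exact (integrableOn_comp_stAffine_iff (by positivity) (inv_pos.2 hc0) 0 (0 : E) _ Q).2 hp
    exact h1.mono_set fun z hz => by
      change stDilate c (-1) z ∈ Q
      have := hW _ hz
      exact this
  -- the difference `f = p ∘ shrink − c² p` is locally integrable on `Q`
  set f : ℝ × E → ℝ := fun z => uncurry p (stDilate c (-1) z) - c ^ 2 * uncurry p z with hf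
  have hfint : IntegrableOn f Q volume := hpΦ.sub (hp.const_mul (c ^ 2))
  have key := hQo.ae_eq_zero_of_integral_contDiff_smul_eq_zero hfint.locallyIntegrableOn ?_
  · filter_upwards [key] with z hz hzQ
    exact sub_eq_zero.1 (hz hzQ)
  intro θ hθ hθc hθs
  -- the dilated test function `θ' = θ ∘ (c²·, c·)`, supported in `Q`
  set θ' : ℝ × E → ℝ := θ ∘ stDilate c 1 with hθ'
  have hθθ' : ∀ z, θ z = θ' (stDilate c (-1) z) := fun z => by
    simp only [hθ', comp_apply, stDilate_one_stDilate_neg_one hc0' z]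
  have hθ'c : HasCompactSupport θ' := by
    rw [hθ', stDilate_eq_stAffine]
    exact hθc.comp_homeomorph (stAffineHomeomorph (β := (c ^ (1 : ℤ)) ^ 2) (γ := c ^ (1 : ℤ))
      (by positivity) (by simp [hc0']) 0 (0 : E))
  have hθ'm : AEStronglyMeasurable θ' (volume.restrict Q) := by
    rw [hθ', stDilate_eq_stAffine]
    exact (hθ.continuous.comp (continuous_stAffine _ _ _ _)).aestronglyMeasurable
  have hθm : AEStronglyMeasurable θ (volume.restrict Q) := hθ.continuous.aestronglyMeasurable
  obtain ⟨Cθ, hCθ⟩ := hθ.continuous.bounded_above_of_compact_support hθc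
  have hθb : ∀ᵐ z ∂(volume.restrict Q), |θ z| ≤ Cθ :=
    Eventually.of_forall fun z => (Real.norm_eq_abs _).symm.le.trans (hCθ z)
  have hθ'b : ∀ᵐ z ∂(volume.restrict Q), |θ' z| ≤ Cθ :=
    Eventually.of_forall fun z => (Real.norm_eq_abs _).symm.le.trans (hCθ _)
  -- `θ` and `θ'` vanish off `Q`
  have hθ0 : ∀ z, z ∉ Q → θ z = 0 := fun z hz => image_eq_zero_of_notMem_tsupport fun h => hz (hθs h)
  have hθ'0 : ∀ z, z ∉ Q → θ' z = 0 := by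
    intro z hz
    have h1 : stDilate c 1 z ∉ Q := fun h => hz (by
      have := hW _ h
      rwa [stDilate_neg_one_stDilate_one hc0'] at this)
    exact hθ0 _ h1
  -- the identity for each `π_j`: `c² ∫_Q π_j θ = κ ∫_Q π_j θ'`
  have hj : ∀ j, c ^ 2 * ∫ z in Q, π j z.1 z.2 * θ z = κ * ∫ z in Q, π j z.1 z.2 * θ' z := by
    intro j
    have e1 : ∫ z in Q, π j z.1 z.2 * θ z = ∫ z, π j z.1 z.2 * θ z :=
      setIntegral_eq_integral_of_forall_compl_eq_zero fun z hz => by rw [hθ0 z hz, mul_zero]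
    have e2 : ∫ z in Q, π j z.1 z.2 * θ' z = ∫ z, π j z.1 z.2 * θ' z :=
      setIntegral_eq_integral_of_forall_compl_eq_zero fun z hz => by rw [hθ'0 z hz, mul_zero]
    rw [e1, e2]
    -- substitute `z = shrink w` in the first integral
    have hcv := integral_comp_stAffine (E := E) (G := ℝ) (β := c⁻¹ ^ 2) (γ := c⁻¹) (by positivity)
      (inv_pos.2 hc0) 0 0 (fun w => π j w.1 w.2 * θ' w)
    rw [← stDilate_neg_one_eq_stAffine] at hcv
    have e3 : (fun z : ℝ × E => π j (stDilate c (-1) z).1 (stDilate c (-1) z).2 *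
        θ' (stDilate c (-1) z)) = fun z => c ^ 2 * (π j z.1 z.2 * θ z) := by
      funext z
      have hd : uncurry (π j) (stDilate c (-1) z) = c ^ 2 * uncurry (π j) z :=
        apply_stDilate_neg_one_of_nsRescalePressure hc0' (hπ j) z
      simp only [uncurry] at hd
      rw [hd, ← hθθ' z]; ring
    rw [e3, integral_const_mul, smul_eq_mul] at hcv
    exact hcv
  -- pass to the limit along the weak convergence
  have hlimθ := hw θ Cθ hθm hθb
  have hlimθ' := hw θ' Cθ hθ'm hθ'b
  have hlim1 : Tendsto (fun j => c ^ 2 * ∫ z in Q, π j z.1 z.2 * θ z) atTop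
      (𝓝 (c ^ 2 * ∫ z in Q, p z.1 z.2 * θ z)) := hlimθ.const_mul _
  have hlim2 : Tendsto (fun j => κ * ∫ z in Q, π j z.1 z.2 * θ' z) atTop
      (𝓝 (κ * ∫ z in Q, p z.1 z.2 * θ' z)) := hlimθ'.const_mul _
  have heq : c ^ 2 * ∫ z in Q, p z.1 z.2 * θ z = κ * ∫ z in Q, p z.1 z.2 * θ' z :=
    tendsto_nhds_unique hlim1 (by simpa only [hj] using hlim2)
  -- undo the change of variables on the limit
  have e1 : ∫ z in Q, p z.1 z.2 * θ z = ∫ z, p z.1 z.2 * θ z :=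
    setIntegral_eq_integral_of_forall_compl_eq_zero fun z hz => by rw [hθ0 z hz, mul_zero]
  have e2 : ∫ z in Q, p z.1 z.2 * θ' z = ∫ z, p z.1 z.2 * θ' z :=
    setIntegral_eq_integral_of_forall_compl_eq_zero fun z hz => by rw [hθ'0 z hz, mul_zero]
  have hcv := integral_comp_stAffine (E := E) (G := ℝ) (β := c⁻¹ ^ 2) (γ := c⁻¹) (by positivity)
    (inv_pos.2 hc0) 0 0 (fun w => p w.1 w.2 * θ' w)
  rw [← stDilate_neg_one_eq_stAffine, smul_eq_mul] at hcv
  have e3 : ∫ z : ℝ × E, p (stDilate c (-1) z).1 (stDilate c (-1) z).2 * θ' (stDilate c (-1) z) =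
      ∫ z : ℝ × E, uncurry p (stDilate c (-1) z) * θ z := by
    refine integral_congr_ae (Eventually.of_forall fun z => ?_)
    simp only [uncurry, ← hθθ' z]
  have e4 : κ * ∫ z, p z.1 z.2 * θ' z = ∫ z : ℝ × E, uncurry p (stDilate c (-1) z) * θ z := by
    rw [← e3]; exact hcv.symm
  rw [e1, e2, e4] at heq
  -- conclude: `∫ θ • f = 0`
  have hθnb : ∀ᵐ z ∂(volume.restrict Q), ‖θ z‖ ≤ Cθ := Eventually.of_forall fun z => hCθ z
  have hsupp : ∀ g : ℝ × E → ℝ, (support fun z => θ z * g z) ⊆ Q := fun g z hz => by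
    by_contra hzQ
    rw [mem_support] at hz
    exact hz (by rw [hθ0 z hzQ, zero_mul])
  have hi1 : Integrable (fun z => θ z * uncurry p (stDilate c (-1) z)) volume :=
    (integrableOn_iff_integrable_of_support_subset (hsupp _)).1 (hpΦ.bdd_mul hθm hθnb)
  have hi2 : Integrable (fun z => θ z * (c ^ 2 * uncurry p z)) volume :=
    (integrableOn_iff_integrable_of_support_subset (hsupp fun z => c ^ 2 * uncurry p z)).1
      ((hp.const_mul (c ^ 2)).bdd_mul hθm hθnb)
  calc ∫ z, θ z • f z = ∫ z, (θ z * uncurry p (stDilate c (-1) z) - θ z * (c ^ 2 * uncurry p z)) := by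
        refine integral_congr_ae (Eventually.of_forall fun z => ?_)
        simp only [hf, smul_eq_mul, mul_sub]
    _ = (∫ z, θ z * uncurry p (stDilate c (-1) z)) - ∫ z, θ z * (c ^ 2 * uncurry p z) :=
        integral_sub hi1 hi2
    _ = 0 := by
        rw [sub_eq_zero]
        have e5 : ∫ z, θ z * uncurry p (stDilate c (-1) z) = ∫ z : ℝ × E, uncurry p (stDilate c (-1) z) * θ z :=
          integral_congr_ae (Eventually.of_forall fun z => mul_comm _ _)
        have e6 : ∫ z, θ z * (c ^ 2 * uncurry p z) = c ^ 2 * ∫ z : ℝ × E, p z.1 z.2 * θ z := by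
          rw [← integral_const_mul]
          refine integral_congr_ae (Eventually.of_forall fun z => ?_)
          simp only [uncurry]; ring
        rw [e5, e6, heq]

end BradshawTsai2019

end Literature.Analysis.FluidPDE

end
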